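import Mathlib
import Summits.ValiantsHypothesis.ValiantsHypothesis.Theses.ChowBorderDepth3
import Summits.ValiantsHypothesis.ValiantsHypothesis.Theorems.ChowBorderDepth3ChowBorderBoundFanInTwoRung

/-!
# Stub H of crux `ChowBorderDepth3.ChowBorderBound` (stmt-ValiantsHypothesis-5936) is implied by
# the crux: the graded normal form loses nothing

Line `registered` (vertex normal form) proves the crux `ChowBorderBound` from its heart, stub H
(`stub_gradedESymBound`: no graded elementary-symmetric system for `per_n` in the chasm range),
via translation, interpolation, rescaling and grading.  This file proves the CONVERSE transfer

  `ChowBorderBound → stub_gradedESymBound`    (`stub_gradedESymBound_of_crux`),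

with the same constant `c` and threshold `max n₀ 1`: graded data `(q, a, m, G_d)` sum
(`FanInTwoRung.local_of_graded`) to a local border expression
`Σ_{i<r} a_i Π_{j<D} (1 + ε m_ij) = ε^q per_n + ε^(q+1) G`, which is itself a border ΣΠΣ
expression with the same `r` and `D` (absorb the weight `a_i` into the first factor; for `D = 0`
the identity is already impossible because the left side is a constant).  Hence H is EXACTLY as
strong as the crux (up to `c ↦ 2c+1` in the other direction): the normal form isolates the open
content without weakening or strengthening it.

References: J. M. Landsberg, *Geometry and complexity theory*, CUP 2017, Cor. 7.5.3.3 (the crux).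
-/

noncomputable section

-- `Summit.ValiantsHypothesis.ValiantsHypothesis.…` is the tree's mandated single-conjunct layout
-- (Sub = Summit), so the duplicated namespace component is intended.
set_option linter.dupNamespace false

namespace Summit.ValiantsHypothesis.ValiantsHypothesis.Theorems.ChowBorderBound.GradedOfCrux

open MvPolynomial Literature.Computability.AlgebraicComplexity
open scoped Polynomial

variable {n r D : ℕ}

/-- A local summand `a · Π_{j<D} (1 + L_j)` with `D ≥ 1` is a product of `D` affine forms: put the
weight into the factor `j = 0`. -/
theorem exists_affine_prod_eq (hD : 1 ≤ D) (a : ℂ[X])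
    (L : Fin D → MvPolynomial (Fin n × Fin n) ℂ[X]) (hL : ∀ j, (L j).totalDegree ≤ 1) :
    ∃ ℓ : Fin D → MvPolynomial (Fin n × Fin n) ℂ[X],
      (∀ j, (ℓ j).totalDegree ≤ 1) ∧ ∏ j, ℓ j = C a * ∏ j, (1 + L j) := by
  classical
  refine ⟨fun j => (if j = ⟨0, hD⟩ then C a else 1) * (1 + L j), fun j => ?_, ?_⟩
  · refine (totalDegree_mul _ _).trans ?_
    have h1 : ((if j = ⟨0, hD⟩ then C a else 1 : MvPolynomial (Fin n × Fin n) ℂ[X])).totalDegree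
        = 0 := by
      split_ifs
      · exact totalDegree_C _
      · exact totalDegree_one
    have h2 : (1 + L j).totalDegree ≤ 1 :=
      (totalDegree_add _ _).trans (max_le (by rw [totalDegree_one]; exact Nat.zero_le _) (hL j))
    omega
  · rw [Finset.prod_mul_distrib, Finset.prod_ite_eq']
    simp

/-- **The crux implies stub H** (same `c`, threshold `max n₀ 1`): a graded elementary-symmetric
system for `per_n` with `r` rows of `D` linear forms yields a border ΣΠΣ expression of the padded
permanent with `r` products of `D` affine forms, which `ChowBorderBound` forbids in the chasm
range.  Together with the line's skeleton (`ChowBorderBound` from H via translate ∘ interpolate ∘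
rescale ∘ grade, at `c ↦ 2c+1`) this shows that H is equivalent to the crux. -/
theorem stub_gradedESymBound_of_crux :
    Summit.ValiantsHypothesis.ValiantsHypothesis.Theses.ChowBorderDepth3.ChowBorderBound →
    ∀ c : ℕ, ∃ n₀ : ℕ, ∀ n ≥ n₀, ∀ r D : ℕ, r ≤ (n + 2) ^ (c * Nat.sqrt n + c) →
    D ≤ (n + 2) ^ (c * Nat.sqrt n + c) →
    ¬ ∃ (q : ℕ) (a : Fin r → Polynomial ℂ) (m : Fin r → Fin D → Fin n × Fin n → Polynomial ℂ)
        (G : ℕ → MvPolynomial (Fin n × Fin n) (Polynomial ℂ)),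
        ∀ d : ℕ, MvPolynomial.C (Polynomial.X ^ d) *
            (∑ i, MvPolynomial.C (a i) *
              ∑ A ∈ Finset.powersetCard d (Finset.univ : Finset (Fin D)),
                ∏ j ∈ A, ∑ v, MvPolynomial.C (m i j v) * MvPolynomial.X v) =
          (if d = n then
              MvPolynomial.C (Polynomial.X ^ q) *
                MvPolynomial.map Polynomial.C
                  (Literature.Computability.AlgebraicComplexity.perPoly (Fin n) ℂ)
            else 0) +
            MvPolynomial.C (Polynomial.X ^ (q + 1)) * G d := by
  intro hC c
  obtain ⟨n₀, hn₀⟩ := hC c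
  refine ⟨max n₀ 1, fun n hn r D hr hD hex => ?_⟩
  obtain ⟨q, a, m, G, h⟩ := hex
  have hn1 : 1 ≤ n := le_trans (le_max_right _ _) hn
  have hloc := FanInTwoRung.local_of_graded q a m G h
  -- the local identity is a border ΣΠΣ expression with the same `r` and `D`
  rcases Nat.eq_zero_or_pos D with rfl | hDpos
  · -- `D = 0`: the left side is the constant `Σ_i a_i`, the right side contains `ε^q per_n`
    simp only [Finset.univ_eq_empty, Finset.prod_empty, mul_one] at hloc
    have h0 := congrArg (coeff (∑ i, Finsupp.single (((1 : Equiv.Perm (Fin n)) i), i) 1)) hloc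
    have hρ : (∑ i, Finsupp.single (((1 : Equiv.Perm (Fin n)) i), i) 1 : Fin n × Fin n →₀ ℕ) ≠ 0 := by
      intro hz
      have := congrArg (fun f : Fin n × Fin n →₀ ℕ => f ((1 : Equiv.Perm (Fin n)) ⟨0, hn1⟩, ⟨0, hn1⟩)) hz
      simp only [Finsupp.coe_zero, Pi.zero_apply, Finsupp.coe_finsetSum, Finset.sum_apply,
        Finsupp.single_apply] at this
      rw [Finset.sum_eq_single (⟨0, hn1⟩ : Fin n)] at this
      · simp at this
      · intro b _ hb
        rw [if_neg]
        intro hbb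
        exact hb (Prod.ext_iff.1 hbb).2
      · simp
    rw [coeff_sum, Finset.sum_eq_zero (fun i _ => by rw [coeff_C, if_neg hρ.symm]), coeff_add,
      coeff_C_mul, coeff_C_mul, coeff_map,
      Summit.ValiantsHypothesis.ValiantsHypothesis.Theorems.ChowBorderDepth3LocalFanInTwo.coeff_perPoly_rho,
      map_one, mul_one] at h0
    have h1 := congrArg (Polynomial.coeff · q) h0
    simp only [Polynomial.coeff_zero, Polynomial.coeff_add, Polynomial.coeff_X_pow, if_true,
      pow_succ, mul_assoc, Polynomial.coeff_X_pow_mul', le_refl, Nat.sub_self] at h1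
    rw [Polynomial.mul_coeff_zero, Polynomial.coeff_X_zero, zero_mul, add_zero] at h1
    exact zero_ne_one h1
  · -- `D ≥ 1`: absorb the weights into the first factors and apply the crux
    have hlin : ∀ i j, (∑ v, C (Polynomial.X * m i j v) * X v :
        MvPolynomial (Fin n × Fin n) ℂ[X]).totalDegree ≤ 1 := by
      intro i j
      refine (totalDegree_finsetSum _ _).trans (Finset.sup_le fun v _ => ?_)
      refine (totalDegree_mul _ _).trans ?_
      rw [totalDegree_C, totalDegree_X, zero_add]
    choose ℓ hℓ hprod using fun i => exists_affine_prod_eq hDpos (a i)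
      (fun j => ∑ v, C (Polynomial.X * m i j v) * X v) (hlin i)
    refine hn₀ n (le_trans (le_max_left _ _) hn) r D hr hD ⟨q, ℓ, ∑ d ∈ Finset.range (D + 1), G d,
      hℓ, ?_⟩
    rw [← hloc]
    exact Finset.sum_congr rfl fun i _ => hprod i

end Summit.ValiantsHypothesis.ValiantsHypothesis.Theorems.ChowBorderBound.GradedOfCrux

end
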